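import Summits.Ventures.CertifiedArithmetic.LowPrec.KahanEnvelope

/-!
# Kahan summation: the envelope under DATA-ONLY hypotheses (`xᵢ ∈ F_α`, `10·Σ|xᵢ| ≤ maxRat`, `nu ≤ ¼`)

HONEST FRAMING (venture CertifiedArithmetic / cell `pub-lowprec`): certified error envelopes and
provably optimal rounding/accumulation schemes for low-precision formats under stated cost models;
every table by two implementations; no hardware or vendor claims.

`KahanEnvelope.lean` bounds Kahan's returned `ŝₙ` under four per-step IN-RANGE conditions and an
external bound `T` on the computed partial sums. This file discharges both from the data, in the
style of `AccumulateRange.lean`: for a format `α` with `emaxCode ≥ 2` and `u ≤ 1/16`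
(binary16/32, bfloat16, OCP `E4M3`, `E2M3`), summands `x₀ … xₙ ∈ F_α` with `n·u ≤ 1/4` and
`10·Σ|xᵢ| ≤ maxRat`, the INVARIANT (`MiniFloat.kahan_invariant`) holds: every computed partial sum
satisfies `|ŝₖ| ≤ 2·Σ|xᵢ|`, every compensation `|cₖ| ≤ 4u(1+u)²·Σ|xᵢ|`, and all four sums formed
in every step are within `±maxRat` (so nothing saturates). Consequently
(`MiniFloat.abs_kahan_sub_sum_le_of_sum_le`)

  `|ŝₙ - Σ xᵢ| ≤ u·|ŝₙ| + (2u + 6u² + 12·n·u²)·Σ|xᵢ|`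

with no hypothesis on the algorithm's intermediate states. The proof is a simultaneous induction:
crude bounds (`|y| ≤ 2S`, `|ŝ'| ≤ 5S`, `|fl(ŝ - ŝ')| ≤ 8S`) give the ranges of the next step from
the invariant, and the envelope of `KahanEnvelope.lean` applied to the prefix (with `T = 5S`)
re-establishes the sharp `|ŝ'| ≤ 2S`. Constants are generous; no sharpness claimed.
-/

namespace Literature.ComputerArithmetic.FloatingPoint

namespace MiniFloat

open Finset

variable {α : Format}

/-- `|fl(z)| ≤ (1+u)|z|` for a sum `z = p + q` of two values in range. [folklore] -/
theorem abs_fl_add_le (hα : 2 ≤ α.emaxCode) {p q : ℚ} (hp : ∃ a : MiniFloat α, a.toRat = p)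
    (hq : ∃ b : MiniFloat α, b.toRat = q) (hr : |p + q| ≤ α.maxRat) :
    |flα α (p + q)| ≤ (1 + α.unitRoundoff) * |p + q| := by
  have h := abs_fl_add_sub_le hα hp hq hr
  have h1 : |flα α (p + q)| ≤ |flα α (p + q) - (p + q)| + |p + q| := by
    have := abs_add_le (flα α (p + q) - (p + q)) (p + q)
    rwa [sub_add_cancel] at this
  linarith

/-- Partial absolute sums are bounded by the total. [folklore] -/
theorem sum_abs_range_le_of_le (x : ℕ → ℚ) {k n : ℕ} (hk : k ≤ n) :
    ∑ i ∈ range (k + 1), |x i| ≤ ∑ i ∈ range (n + 1), |x i| :=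
  sum_le_sum_of_subset_of_nonneg (range_subset_range.mpr (by omega)) (fun _ _ _ => abs_nonneg _)

/-- THE INVARIANT of Kahan's loop under data-only hypotheses: with `S = Σ_{i≤n}|xᵢ|`,
`u ≤ 1/16`, `n·u ≤ 1/4`, `10S ≤ maxRat`: for every `k ≤ n`, (i) `|ŝⱼ| ≤ 2S` for `j ≤ k`,
(ii) `|cⱼ| ≤ 4u(1+u)²·S` for `j ≤ k`, (iii) the four sums of every step `j < k` are in range.
[folklore] -/
theorem kahan_invariant (hα : 2 ≤ α.emaxCode) (hu16 : α.unitRoundoff ≤ 1 / 16) (x : ℕ → ℚ)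
    (n : ℕ) (hnu : (n : ℚ) * α.unitRoundoff ≤ 1 / 4) (hx : ∀ i ≤ n, ∃ y : MiniFloat α, y.toRat = x i)
    (hS : 10 * ∑ i ∈ range (n + 1), |x i| ≤ α.maxRat) :
    ∀ k ≤ n,
      (∀ j ≤ k, |(kahan α x j).1| ≤ 2 * ∑ i ∈ range (n + 1), |x i|) ∧
      (∀ j ≤ k, |(kahan α x j).2|
        ≤ 4 * (α.unitRoundoff * (1 + α.unitRoundoff) ^ 2) * ∑ i ∈ range (n + 1), |x i|) ∧
      (∀ j < k, |x (j + 1) + (kahan α x j).2| ≤ α.maxRat ∧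
        |(kahan α x j).1 + kahanY α x j| ≤ α.maxRat ∧
        |(kahan α x j).1 - (kahan α x (j + 1)).1| ≤ α.maxRat ∧
        |flα α ((kahan α x j).1 - (kahan α x (j + 1)).1) + kahanY α x j| ≤ α.maxRat) := by
  have hu := α.unitRoundoff_pos
  set u := α.unitRoundoff with hu_def
  set S := ∑ i ∈ range (n + 1), |x i| with hS_def
  have hS0 : 0 ≤ S := sum_nonneg (fun i _ => abs_nonneg (x i))
  set γ := u * (1 + u) ^ 2 with hγ_def
  have hγ0 : 0 ≤ γ := by positivity
  have hγ1 : 4 * γ ≤ 1 / 3 := by rw [hγ_def]; nlinarith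
  -- |x i| ≤ S
  have hxi : ∀ i ≤ n, |x i| ≤ S := fun i hi =>
    le_trans (single_le_sum (f := fun i => |x i|) (fun _ _ => abs_nonneg _)
      (mem_range.mpr (Nat.lt_succ_of_le hi))) le_rfl
  intro k
  induction k with
  | zero =>
      intro _
      refine ⟨fun j hj => ?_, fun j hj => ?_, fun j hj => absurd hj (Nat.not_lt_zero _)⟩
      · obtain rfl : j = 0 := Nat.le_zero.mp hj
        rw [kahan_zero_fst]; unfold flα
        rw [toRat_roundNE_of_exists (hx 0 (Nat.zero_le _))]
        linarith [hxi 0 (Nat.zero_le _)]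
      · obtain rfl : j = 0 := Nat.le_zero.mp hj
        rw [kahan_zero_snd, abs_zero]; positivity
  | succ k ih =>
      intro hk
      obtain ⟨ihs, ihc, ihr⟩ := ih (Nat.le_of_succ_le hk)
      -- the data of step k+1
      have hsk := ihs k le_rfl
      have hck := ihc k le_rfl
      have hxk := hxi (k + 1) hk
      have hxF := hx (k + 1) hk
      have hsF := exists_toRat_eq_kahan_fst (α := α) x k
      have hcF := exists_toRat_eq_kahan_snd (α := α) x k
      have hyF := exists_toRat_eq_kahanY (α := α) x k
      have huS : u * S ≤ S / 16 := by nlinarith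
      have hcS : |(kahan α x k).2| ≤ S / 3 := le_trans hck (by nlinarith)
      -- cond 1
      have hxc : |x (k + 1)| + |(kahan α x k).2| ≤ 4 * S / 3 := by linarith
      have hc1 : |x (k + 1) + (kahan α x k).2| ≤ α.maxRat := by
        have := abs_add_le (x (k + 1)) ((kahan α x k).2); linarith
      -- |y| ≤ 2S
      have hy : |kahanY α x k| ≤ 2 * S := by
        have h1 := abs_kahanY_le hα x k hxF hc1
        have h2 := mul_le_mul_of_nonneg_left hxc (by linarith : 0 ≤ 1 + u)
        have h3 : (1 + u) * (4 * S / 3) = 4 * S / 3 + 4 * (u * S) / 3 := by ring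
        linarith
      -- cond 2
      have hsy : |(kahan α x k).1 + kahanY α x k| ≤ 4 * S := by
        have := abs_add_le ((kahan α x k).1) (kahanY α x k); linarith
      have hc2 : |(kahan α x k).1 + kahanY α x k| ≤ α.maxRat := by linarith
      -- crude |ŝ'| ≤ 5S
      have hs'F := exists_toRat_eq_kahan_fst (α := α) x (k + 1)
      have hs'crude : |(kahan α x (k + 1)).1| ≤ 5 * S := by
        rw [kahan_succ_fst]
        have h1 := abs_fl_add_le hα hsF hyF hc2
        have h2 := mul_le_mul_of_nonneg_left hsy (by linarith : 0 ≤ 1 + u)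
        have h3 : (1 + u) * (4 * S) = 4 * S + 4 * (u * S) := by ring
        linarith
      -- cond 3
      have hss : |(kahan α x k).1 - (kahan α x (k + 1)).1| ≤ 7 * S := by
        have := abs_sub ((kahan α x k).1) ((kahan α x (k + 1)).1); linarith
      have hc3 : |(kahan α x k).1 - (kahan α x (k + 1)).1| ≤ α.maxRat := by linarith
      -- cond 4
      have hc4 : |flα α ((kahan α x k).1 - (kahan α x (k + 1)).1) + kahanY α x k| ≤ α.maxRat := by
        have hd : |flα α ((kahan α x k).1 - (kahan α x (k + 1)).1)| ≤ 8 * S := by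
          have h := abs_fl_add_le hα hsF (exists_toRat_eq_neg hs'F) (p := (kahan α x k).1)
            (q := -(kahan α x (k + 1)).1) (by rw [← sub_eq_add_neg]; exact hc3)
          rw [← sub_eq_add_neg] at h
          have h2 := mul_le_mul_of_nonneg_left hss (by linarith : 0 ≤ 1 + u)
          have h3 : (1 + u) * (7 * S) = 7 * S + 7 * (u * S) := by ring
          linarith
        have := abs_add_le (flα α ((kahan α x k).1 - (kahan α x (k + 1)).1)) (kahanY α x k)
        linarith
      -- ranges for all j < k+1
      have hr' : ∀ j < k + 1, |x (j + 1) + (kahan α x j).2| ≤ α.maxRat ∧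
          |(kahan α x j).1 + kahanY α x j| ≤ α.maxRat ∧
          |(kahan α x j).1 - (kahan α x (j + 1)).1| ≤ α.maxRat ∧
          |flα α ((kahan α x j).1 - (kahan α x (j + 1)).1) + kahanY α x j| ≤ α.maxRat := by
        intro j hj
        rcases Nat.lt_succ_iff_lt_or_eq.mp hj with hj' | rfl
        · exact ihr j hj'
        · exact ⟨hc1, hc2, hc3, hc4⟩
      -- sharp |ŝ'| ≤ 2S by the envelope on the prefix with T = 5S
      have hs' : |(kahan α x (k + 1)).1| ≤ 2 * S := by
        have hT : ∀ j ≤ k + 1, |(kahan α x j).1| ≤ 5 * S := by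
          intro j hj
          rcases Nat.lt_succ_iff_lt_or_eq.mp (Nat.lt_succ_of_le hj) with hj' | rfl
          · linarith [ihs j (Nat.lt_succ_iff.mp hj')]
          · exact hs'crude
        have henv := abs_kahan_sub_sum_le hα (by linarith) x (k + 1)
          (fun i hi => hx i (le_trans hi hk)) hr' hT
        have hSk : ∑ i ∈ range (k + 1 + 1), |x i| ≤ S := sum_abs_range_le_of_le x hk
        have hsum : |∑ i ∈ range (k + 1 + 1), x i| ≤ S :=
          le_trans (abs_sum_le_sum_abs _ _) hSk
        have hk1 : ((k + 1 : ℕ) : ℚ) * u ≤ 1 / 4 :=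
          le_trans (mul_le_mul_of_nonneg_right (by exact_mod_cast hk) hu.le) hnu
        -- |ŝ'| ≤ |Σ x| + |ŝ' - Σ x|
        have htri : |(kahan α x (k + 1)).1| ≤ |(kahan α x (k + 1)).1 - ∑ i ∈ range (k + 1 + 1), x i|
            + |∑ i ∈ range (k + 1 + 1), x i| := by
          have := abs_add_le ((kahan α x (k + 1)).1 - ∑ i ∈ range (k + 1 + 1), x i)
            (∑ i ∈ range (k + 1 + 1), x i)
          rwa [sub_add_cancel] at this
        have hA : (2 * u + 6 * u ^ 2) * ∑ i ∈ range (k + 1 + 1), |x i| ≤ (2 * u + 6 * u ^ 2) * S :=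
          mul_le_mul_of_nonneg_left hSk (by positivity)
        have hB : 6 * ((k + 1 : ℕ) : ℚ) * u ^ 2 * (5 * S) ≤ 8 * u * S := by
          have : 6 * ((k + 1 : ℕ) : ℚ) * u ^ 2 * (5 * S) = 30 * (((k + 1 : ℕ) : ℚ) * u) * (u * S) := by
            ring
          rw [this]; nlinarith [mul_nonneg hu.le hS0]
        set s' := |(kahan α x (k + 1)).1| with hs'_def
        have hs'0 : 0 ≤ s' := abs_nonneg _
        nlinarith [henv, htri, hA, hB, hsum, mul_nonneg hu.le hs'0]
      -- |c'| ≤ 4γS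
      have hc' : |(kahan α x (k + 1)).2| ≤ 4 * γ * S := by
        have h := abs_kahan_snd_succ_le hα x k hxF hc1 hc2 hc3 hc4
        rw [← hu_def, ← hγ_def] at h
        nlinarith
      refine ⟨fun j hj => ?_, fun j hj => ?_, hr'⟩
      · rcases Nat.lt_succ_iff_lt_or_eq.mp (Nat.lt_succ_of_le hj) with hj' | rfl
        · exact ihs j (Nat.lt_succ_iff.mp hj')
        · exact hs'
      · rcases Nat.lt_succ_iff_lt_or_eq.mp (Nat.lt_succ_of_le hj) with hj' | rfl
        · exact ihc j (Nat.lt_succ_iff.mp hj')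
        · exact hc'

/-- KAHAN SUMMATION UNDER DATA-ONLY HYPOTHESES: format `α` with `emaxCode ≥ 2` and `u ≤ 1/16`;
summands `x₀, …, xₙ ∈ F_α` with `n·u ≤ 1/4` and `10·Σ|xᵢ| ≤ maxRat`. Then nothing saturates and the
returned sum satisfies `|ŝₙ - Σᵢ xᵢ| ≤ u|ŝₙ| + (2u + 6u² + 12·n·u²)·Σᵢ|xᵢ|`.
[cite: Higham2002ASNA, Alg. 4.2 and (4.9)] -/
theorem abs_kahan_sub_sum_le_of_sum_le (hα : 2 ≤ α.emaxCode) (hu16 : α.unitRoundoff ≤ 1 / 16)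
    (x : ℕ → ℚ) (n : ℕ) (hnu : (n : ℚ) * α.unitRoundoff ≤ 1 / 4)
    (hx : ∀ i ≤ n, ∃ y : MiniFloat α, y.toRat = x i)
    (hS : 10 * ∑ i ∈ range (n + 1), |x i| ≤ α.maxRat) :
    |(kahan α x n).1 - ∑ i ∈ range (n + 1), x i|
      ≤ α.unitRoundoff * |(kahan α x n).1|
        + (2 * α.unitRoundoff + 6 * α.unitRoundoff ^ 2 + 12 * n * α.unitRoundoff ^ 2)
          * ∑ i ∈ range (n + 1), |x i| := by
  obtain ⟨hs, -, hr⟩ := kahan_invariant hα hu16 x n hnu hx hS n le_rfl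
  have h := abs_kahan_sub_sum_le hα (by linarith) x n hx hr hs
  linarith

/-- The compensated pair under the same data-only hypotheses:
`|ŝₙ + cₙ - Σᵢ xᵢ| ≤ (2u + 6u² + 12·n·u²)·Σᵢ|xᵢ|`. [cite: Higham2002ASNA, Alg. 4.2 and (4.9)] -/
theorem abs_kahan_pair_sub_sum_le_of_sum_le (hα : 2 ≤ α.emaxCode) (hu16 : α.unitRoundoff ≤ 1 / 16)
    (x : ℕ → ℚ) (n : ℕ) (hnu : (n : ℚ) * α.unitRoundoff ≤ 1 / 4)
    (hx : ∀ i ≤ n, ∃ y : MiniFloat α, y.toRat = x i)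
    (hS : 10 * ∑ i ∈ range (n + 1), |x i| ≤ α.maxRat) :
    |(kahan α x n).1 + (kahan α x n).2 - ∑ i ∈ range (n + 1), x i|
      ≤ (2 * α.unitRoundoff + 6 * α.unitRoundoff ^ 2 + 12 * n * α.unitRoundoff ^ 2)
          * ∑ i ∈ range (n + 1), |x i| := by
  obtain ⟨hs, -, hr⟩ := kahan_invariant hα hu16 x n hnu hx hS n le_rfl
  have h := abs_kahan_pair_sub_sum_le hα (by linarith) x n hx hr hs
  linarith

/-- No saturation and bounded states under the data-only hypotheses (for the record): every
`|ŝₖ| ≤ 2Σ|xᵢ|` and `|cₖ| ≤ 4u(1+u)²Σ|xᵢ|`. [folklore] -/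
theorem kahan_states_bounded (hα : 2 ≤ α.emaxCode) (hu16 : α.unitRoundoff ≤ 1 / 16)
    (x : ℕ → ℚ) (n : ℕ) (hnu : (n : ℚ) * α.unitRoundoff ≤ 1 / 4)
    (hx : ∀ i ≤ n, ∃ y : MiniFloat α, y.toRat = x i)
    (hS : 10 * ∑ i ∈ range (n + 1), |x i| ≤ α.maxRat) (k : ℕ) (hk : k ≤ n) :
    |(kahan α x k).1| ≤ 2 * ∑ i ∈ range (n + 1), |x i| ∧
    |(kahan α x k).2| ≤ 4 * (α.unitRoundoff * (1 + α.unitRoundoff) ^ 2) * ∑ i ∈ range (n + 1), |x i| := by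
  obtain ⟨hs, hc, -⟩ := kahan_invariant hα hu16 x n hnu hx hS n le_rfl
  exact ⟨hs k hk, hc k hk⟩

end MiniFloat

end Literature.ComputerArithmetic.FloatingPoint
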